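import Summits.Ventures.CertifiedManyBodySolver.Rows.TorusCeilingCRT
import Literature.MathematicalPhysics.QuantumLattice.HubbardRectangularTorus
import HarnessLib

/-!
# Torus ceiling — Part VI: the CRT rings ARE the rectangular tori `3 × 4`, `3 × 5` (kernel rows)

HONEST FRAMING: first certified bounds; not a superconductivity verdict; every number certified or
labelled float.
The CRT site bijections `crtEquiv34 : FermionTorus 1 12 ≃ Fin 3 ×ₗ Fin 4`, `k ↦ (k mod 3, k mod 4)`, and
`crtEquiv35 : FermionTorus 1 15 ≃ Fin 3 ×ₗ Fin 5` are graph isomorphisms from the Cayley graphs of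
`crtHom34` / `crtHom43` (hop set `{±4, ±9}`) resp. `crtHom35` / `crtHom53` (`{±10, ±6}`) onto the
tree's `fermionRectTorusGraph 3 4` / `3 5` — checked by `decide` over all `144` / `225` pairs. With
`groundEnergyAt_eq_of_iso` and `groundEnergyAt_eq_minEnergyOn_szSector` the ring corollaries of Part V
become the KERNEL ROWS
`rect34_groundEnergyAt_div_ge_of_window_certificate[_transposed]` /
`rect35_groundEnergyAt_div_ge_of_window_certificate[_transposed]`: a square-lattice window certificate
of the Literature shape whose window has coordinate spreads `≤ (2, 3)` or `(3, 2)` (resp. `≤ (2, 4)` or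
`(4, 2)`) satisfies, for every `n ≤ 12` (resp. `15`),
`c − Σ‖aₖ‖ + (Σ_σ μ_σ)(n/12 − ν) ≤ groundEnergyAt (fermionRectTorusGraph 3 4) t U (2n) / 12`
(resp. `3 5`, `/15`). So the d-general abstract-torus engine covers rectangular PP tori without a
rectangular Fock-space engine. Not covered (correctly): twisted rectangular sectors (a ring flux mixes
the two seam directions), point-group rows.

References: Han 2020 §3; Kull–Schuch–Dive–Navascués 2024 §5.3. [cite: Han2020Bootstrap, §3]
[cite: KullEtAl2024, §5.3]
-/

noncomputable section

open Matrix Finset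
open Literature.MathematicalPhysics.QuantumLattice
open Literature.MathematicalPhysics.QuantumFieldTheory hiding Site
open Literature.MathematicalPhysics.QuantumManyBody.StateRelaxation
open Literature.Probability.LatticeModels
open HubbardWave0
open scoped ComplexOrder ComplexConjugate

namespace Summit.Ventures.CertifiedManyBodySolver.Rows

section Rect34

/-! ### The CRT ring `ℤ/12` with hops `{±3, ±4}` IS the `3 × 4` torus -/

/-- CRT coordinates on `ℤ/12`: `k ↦ (k mod 3, k mod 4)`. [folklore] -/
def crt34Pair (k : Fin 12) : Fin 3 × Fin 4 :=
  (⟨(k : ℕ) % 3, Nat.mod_lt _ (by norm_num)⟩, ⟨(k : ℕ) % 4, Nat.mod_lt _ (by norm_num)⟩)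

/-- The CRT inverse on `ℤ/3 × ℤ/4`: `(u, w) ↦ 4u + 9w mod 12`. [folklore] -/
def crt34Inv (q : Fin 3 × Fin 4) : Fin 12 :=
  ⟨(4 * (q.1 : ℕ) + 9 * (q.2 : ℕ)) % 12, Nat.mod_lt _ (by norm_num)⟩

/-- `crt34Inv ∘ crt34Pair = id` (Chinese remainder theorem for `12 = 3 · 4`, checked). [folklore] -/
theorem crt34Inv_crt34Pair : ∀ k : Fin 12, crt34Inv (crt34Pair k) = k := by decide

/-- `crt34Pair ∘ crt34Inv = id` (Chinese remainder theorem for `12 = 3 · 4`, checked). [folklore] -/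
theorem crt34Pair_crt34Inv : ∀ q : Fin 3 × Fin 4, crt34Pair (crt34Inv q) = q := by decide

/-- **The CRT site bijection** `FermionTorus 1 12 ≃ Fin 3 ×ₗ Fin 4`, `k ↦ (k mod 3, k mod 4)`.
[folklore] -/
def crtEquiv34 : FermionTorus 1 12 ≃ Fin 3 ×ₗ Fin 4 where
  toFun x := toLex (crt34Pair (ofLex x 0))
  invFun q := toLex fun _ => crt34Inv (ofLex q)
  left_inv x := by
    refine ofLex.injective (funext fun j => ?_)
    rw [Subsingleton.elim j 0]
    exact crt34Inv_crt34Pair (ofLex x 0)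
  right_inv q := ofLex.injective (crt34Pair_crt34Inv (ofLex q))

/-- The adjacency check behind `fermionRectTorusGraph_adj_crtEquiv34`: on residues `k, k' ∈ ℤ/12`,
"`(k mod 3, k mod 4) ∼ (k' mod 3, k' mod 4)` in the `3 × 4` torus" iff "`k' − k ∈ {±4, ±9}`"
(all `144` pairs, by `decide`). [folklore] -/
theorem crt34_adj_iff : ∀ k k' : Fin 12,
    (fermionRectTorusGraph 3 4).Adj (toLex (crt34Pair k)) (toLex (crt34Pair k')) ↔
      (((k : ℕ) : ZMod 12) ≠ ((k' : ℕ) : ZMod 12) ∧ ∃ i : Fin 2,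
        ((k' : ℕ) : ZMod 12) = ((k : ℕ) : ZMod 12) + ((![4, 9] i : ℤ) : ZMod 12) ∨
          ((k : ℕ) : ZMod 12) = ((k' : ℕ) : ZMod 12) + ((![4, 9] i : ℤ) : ZMod 12)) := by
  decide

/-- **The CRT ring is the `3 × 4` torus**: `crtEquiv34` is a graph isomorphism from the Cayley graph
of `ℤ/12` generated by `crtHom34` (hops `±4`, `±9 = ∓3`) onto the tree's rectangular fermionic torus
`fermionRectTorusGraph 3 4`. [folklore] -/
theorem fermionRectTorusGraph_adj_crtEquiv34 (x y : FermionTorus 1 12) :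
    (fermionRectTorusGraph 3 4).Adj (crtEquiv34 x) (crtEquiv34 y) ↔ (homTorusGraph crtHom34).Adj x y := by
  rw [homTorusGraph_adj, homSiteGraph_adj_iff, show crtEquiv34 x = toLex (crt34Pair (ofLex x 0)) from rfl,
    show crtEquiv34 y = toLex (crt34Pair (ofLex y 0)) from rfl, crt34_adj_iff]
  have hts : ∀ u : FermionTorus 1 12, u.toTorusSite = fun _ => ((ofLex u 0 : ℕ) : ZMod 12) :=
    fun u => funext fun j => by rw [Subsingleton.elim j 0]; rfl
  have hc : ∀ i : Fin 2, crtHom34 (unitVec i) = fun _ => ((![4, 9] i : ℤ) : ZMod 12) :=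
    fun i => ringHom_unitVec 12 ![4, 9] i
  simp only [hts, hc, ne_eq, funext_iff, Fin.forall_fin_one, Pi.add_apply]

/-- **Window certificate ⇒ the `3 × 4` PP Hubbard torus, as a ground-state energy.** With the data
of `crt34_minEnergyOn_div_ge_of_window_certificate` (square-lattice window certificate, window of
coordinate spreads `≤ 2`, `≤ 3`), for every `n ≤ 12`:
`c − Σ‖aₖ‖ + (Σ_σ μ_σ)(n/12 − ν) ≤ E₀(fermionRectTorusGraph 3 4, t, U; 2n electrons) / 12`
(graph-isomorphism invariance `groundEnergyAt_eq_of_iso` along `crtEquiv34`, and the `S^z = 0`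
reduction `groundEnergyAt_eq_minEnergyOn_szSector`). This is the kernel form of the cell's
"PP `3 × 4` torus row" of CEILING-PAGE §3. [cite: Han2020Bootstrap, §3] -/
theorem rect34_groundEnergyAt_div_ge_of_window_certificate (t U : ℝ) {nh : ℕ}
    (hn : nh ≤ Fintype.card (FermionTorus 1 12))
    {Λ Λ' : Finset (Site 2)} (hΛ : Λ ⊆ Λ')
    (hspread : ∀ x ∈ Λ', ∀ y ∈ Λ', |x 0 - y 0| ≤ (2 : ℤ) ∧ |x 1 - y 1| ≤ (3 : ℤ))
    (hclosed : ∀ x ∈ Λ, ∀ i : Fin 2, x + unitVec i ∈ Λ' ∧ x - unitVec i ∈ Λ')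
    (h0 : thicken ({0} : Finset (Site 2)) 1 ⊆ Λ') (hz : (0 : Site 2) ∈ Λ')
    (μ : Fin 2 → ℝ) (ν : ℝ)
    {m : Type*} [Fintype m] [DecidableEq m] {Λm : Matrix m m ℂ} (hΛm : Λm.PosSemidef)
    (O : m → FermionOp Λ')
    {κ : Type*} (s : Finset κ) (B : κ → FermionOp Λ)
    {ι : Type*} (tt : Finset ι) (v : ι → Site 2) (hsh : ∀ l, shiftSet (v l) Λ ⊆ Λ') (Y : ι → FermionOp Λ)
    {γ : Type*} (u : Finset γ) (b : γ → ℂ) (cw : γ → List (Orb (PolySite Λ') × Bool))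
    (hcw : ∀ j ∈ u, ladderCharge (cw j) ≠ 0 ∨ ladderSpinCharge (cw j) ≠ 0)
    {δ : Type*} (ah : Finset δ) (dc : δ → ℝ) (V : δ → FermionOp Λ')
    {κ'' : Type*} (w : Finset κ'') (a : κ'' → ℂ) (word : κ'' → List (Orb (PolySite Λ') × Bool)) {c : ℝ}
    (hcert : fermionEmbed (PolySite.incl h0) ((hubbardFermionInteraction 2 t U).meanEnergyObs 1) -
        (c : ℂ) • (1 : FermionOp Λ') -
        ∑ σ : Fin 2, ((μ σ : ℝ) : ℂ) • (nAt 0 hz σ - ((ν : ℝ) : ℂ) • (1 : FermionOp Λ')) =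
      gramForm Λm O +
        (∑ k ∈ s, ((hubbardFermionInteraction 2 t U).localHamiltonian Λ' * fermionEmbed (PolySite.incl hΛ) (B k) -
            fermionEmbed (PolySite.incl hΛ) (B k) * (hubbardFermionInteraction 2 t U).localHamiltonian Λ') +
          ∑ l ∈ tt, (fermionEmbed (PolySite.incl (hsh l)) (fermionEmbed (PolySite.shiftEmb (v l) Λ) (Y l)) -
            fermionEmbed (PolySite.incl hΛ) (Y l)) +
          ∑ j ∈ u, b j • ladderWord (cw j)) +
        (∑ m' ∈ ah, ((dc m' : ℝ) : ℂ) • ((V m')ᴴ - V m') + ∑ k ∈ w, a k • ladderWord (word k))) :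
    c - ∑ k ∈ w, ‖a k‖ + (∑ σ : Fin 2, μ σ) * ((nh : ℝ) / 12 - ν) ≤
      groundEnergyAt (fermionRectTorusGraph 3 4) t U (2 * nh) / 12 := by
  rw [groundEnergyAt_eq_of_iso (homTorusGraph crtHom34) (fermionRectTorusGraph 3 4) crtEquiv34
      fermionRectTorusGraph_adj_crtEquiv34 t U, groundEnergyAt_eq_minEnergyOn_szSector (homTorusGraph crtHom34) t U hn]
  exact crt34_minEnergyOn_div_ge_of_window_certificate t U hn hΛ hspread hclosed h0 hz μ ν hΛm O s B tt v hsh Y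
    u b cw hcw ah dc V w a word hcert

end Rect34

section Rect35

/-! ### The CRT ring `ℤ/15` with hops `{±5, ±6}` IS the `3 × 5` torus -/

/-- CRT coordinates on `ℤ/15`: `k ↦ (k mod 3, k mod 5)`. [folklore] -/
def crt35Pair (k : Fin 15) : Fin 3 × Fin 5 :=
  (⟨(k : ℕ) % 3, Nat.mod_lt _ (by norm_num)⟩, ⟨(k : ℕ) % 5, Nat.mod_lt _ (by norm_num)⟩)

/-- The CRT inverse on `ℤ/3 × ℤ/5`: `(u, w) ↦ 10u + 6w mod 15`. [folklore] -/
def crt35Inv (q : Fin 3 × Fin 5) : Fin 15 :=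
  ⟨(10 * (q.1 : ℕ) + 6 * (q.2 : ℕ)) % 15, Nat.mod_lt _ (by norm_num)⟩

/-- `crt35Inv ∘ crt35Pair = id` (Chinese remainder theorem for `15 = 3 · 5`, checked). [folklore] -/
theorem crt35Inv_crt35Pair : ∀ k : Fin 15, crt35Inv (crt35Pair k) = k := by decide

/-- `crt35Pair ∘ crt35Inv = id` (Chinese remainder theorem for `15 = 3 · 5`, checked). [folklore] -/
theorem crt35Pair_crt35Inv : ∀ q : Fin 3 × Fin 5, crt35Pair (crt35Inv q) = q := by decide

/-- **The CRT site bijection** `FermionTorus 1 15 ≃ Fin 3 ×ₗ Fin 5`, `k ↦ (k mod 3, k mod 5)`.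
[folklore] -/
def crtEquiv35 : FermionTorus 1 15 ≃ Fin 3 ×ₗ Fin 5 where
  toFun x := toLex (crt35Pair (ofLex x 0))
  invFun q := toLex fun _ => crt35Inv (ofLex q)
  left_inv x := by
    refine ofLex.injective (funext fun j => ?_)
    rw [Subsingleton.elim j 0]
    exact crt35Inv_crt35Pair (ofLex x 0)
  right_inv q := ofLex.injective (crt35Pair_crt35Inv (ofLex q))

/-- The adjacency check behind `fermionRectTorusGraph_adj_crtEquiv35` (all `225` pairs, by `decide`).
[folklore] -/
theorem crt35_adj_iff : ∀ k k' : Fin 15,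
    (fermionRectTorusGraph 3 5).Adj (toLex (crt35Pair k)) (toLex (crt35Pair k')) ↔
      (((k : ℕ) : ZMod 15) ≠ ((k' : ℕ) : ZMod 15) ∧ ∃ i : Fin 2,
        ((k' : ℕ) : ZMod 15) = ((k : ℕ) : ZMod 15) + ((![10, 6] i : ℤ) : ZMod 15) ∨
          ((k : ℕ) : ZMod 15) = ((k' : ℕ) : ZMod 15) + ((![10, 6] i : ℤ) : ZMod 15)) := by
  decide

/-- **The CRT ring is the `3 × 5` torus**: `crtEquiv35` is a graph isomorphism from the Cayley graph
of `ℤ/15` generated by `crtHom35` (hops `±10 = ∓5`, `±6`) onto `fermionRectTorusGraph 3 5`.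
[folklore] -/
theorem fermionRectTorusGraph_adj_crtEquiv35 (x y : FermionTorus 1 15) :
    (fermionRectTorusGraph 3 5).Adj (crtEquiv35 x) (crtEquiv35 y) ↔ (homTorusGraph crtHom35).Adj x y := by
  rw [homTorusGraph_adj, homSiteGraph_adj_iff, show crtEquiv35 x = toLex (crt35Pair (ofLex x 0)) from rfl,
    show crtEquiv35 y = toLex (crt35Pair (ofLex y 0)) from rfl, crt35_adj_iff]
  have hts : ∀ u : FermionTorus 1 15, u.toTorusSite = fun _ => ((ofLex u 0 : ℕ) : ZMod 15) :=
    fun u => funext fun j => by rw [Subsingleton.elim j 0]; rfl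
  have hc : ∀ i : Fin 2, crtHom35 (unitVec i) = fun _ => ((![10, 6] i : ℤ) : ZMod 15) :=
    fun i => ringHom_unitVec 15 ![10, 6] i
  simp only [hts, hc, ne_eq, funext_iff, Fin.forall_fin_one, Pi.add_apply]

/-- **Window certificate ⇒ the `3 × 5` PP Hubbard torus, as a ground-state energy**: with the data
of `crt35_minEnergyOn_div_ge_of_window_certificate`, for every `n ≤ 15`,
`c − Σ‖aₖ‖ + (Σ_σ μ_σ)(n/15 − ν) ≤ E₀(fermionRectTorusGraph 3 5, t, U; 2n electrons) / 15`.
[cite: Han2020Bootstrap, §3] -/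
theorem rect35_groundEnergyAt_div_ge_of_window_certificate (t U : ℝ) {nh : ℕ}
    (hn : nh ≤ Fintype.card (FermionTorus 1 15))
    {Λ Λ' : Finset (Site 2)} (hΛ : Λ ⊆ Λ')
    (hspread : ∀ x ∈ Λ', ∀ y ∈ Λ', |x 0 - y 0| ≤ (2 : ℤ) ∧ |x 1 - y 1| ≤ (4 : ℤ))
    (hclosed : ∀ x ∈ Λ, ∀ i : Fin 2, x + unitVec i ∈ Λ' ∧ x - unitVec i ∈ Λ')
    (h0 : thicken ({0} : Finset (Site 2)) 1 ⊆ Λ') (hz : (0 : Site 2) ∈ Λ')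
    (μ : Fin 2 → ℝ) (ν : ℝ)
    {m : Type*} [Fintype m] [DecidableEq m] {Λm : Matrix m m ℂ} (hΛm : Λm.PosSemidef)
    (O : m → FermionOp Λ')
    {κ : Type*} (s : Finset κ) (B : κ → FermionOp Λ)
    {ι : Type*} (tt : Finset ι) (v : ι → Site 2) (hsh : ∀ l, shiftSet (v l) Λ ⊆ Λ') (Y : ι → FermionOp Λ)
    {γ : Type*} (u : Finset γ) (b : γ → ℂ) (cw : γ → List (Orb (PolySite Λ') × Bool))
    (hcw : ∀ j ∈ u, ladderCharge (cw j) ≠ 0 ∨ ladderSpinCharge (cw j) ≠ 0)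
    {δ : Type*} (ah : Finset δ) (dc : δ → ℝ) (V : δ → FermionOp Λ')
    {κ'' : Type*} (w : Finset κ'') (a : κ'' → ℂ) (word : κ'' → List (Orb (PolySite Λ') × Bool)) {c : ℝ}
    (hcert : fermionEmbed (PolySite.incl h0) ((hubbardFermionInteraction 2 t U).meanEnergyObs 1) -
        (c : ℂ) • (1 : FermionOp Λ') -
        ∑ σ : Fin 2, ((μ σ : ℝ) : ℂ) • (nAt 0 hz σ - ((ν : ℝ) : ℂ) • (1 : FermionOp Λ')) =
      gramForm Λm O +
        (∑ k ∈ s, ((hubbardFermionInteraction 2 t U).localHamiltonian Λ' * fermionEmbed (PolySite.incl hΛ) (B k) -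
            fermionEmbed (PolySite.incl hΛ) (B k) * (hubbardFermionInteraction 2 t U).localHamiltonian Λ') +
          ∑ l ∈ tt, (fermionEmbed (PolySite.incl (hsh l)) (fermionEmbed (PolySite.shiftEmb (v l) Λ) (Y l)) -
            fermionEmbed (PolySite.incl hΛ) (Y l)) +
          ∑ j ∈ u, b j • ladderWord (cw j)) +
        (∑ m' ∈ ah, ((dc m' : ℝ) : ℂ) • ((V m')ᴴ - V m') + ∑ k ∈ w, a k • ladderWord (word k))) :
    c - ∑ k ∈ w, ‖a k‖ + (∑ σ : Fin 2, μ σ) * ((nh : ℝ) / 15 - ν) ≤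
      groundEnergyAt (fermionRectTorusGraph 3 5) t U (2 * nh) / 15 := by
  rw [groundEnergyAt_eq_of_iso (homTorusGraph crtHom35) (fermionRectTorusGraph 3 5) crtEquiv35
      fermionRectTorusGraph_adj_crtEquiv35 t U, groundEnergyAt_eq_minEnergyOn_szSector (homTorusGraph crtHom35) t U hn]
  exact crt35_minEnergyOn_div_ge_of_window_certificate t U hn hΛ hspread hclosed h0 hz μ ν hΛm O s B tt v hsh Y
    u b cw hcw ah dc V w a word hcert

end Rect35

section Transposed

/-! ### Transposed windows (`crtHom43`, `crtHom53`): the same isomorphisms, the other orientation -/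

/-- The adjacency check behind `fermionRectTorusGraph_adj_crtEquiv34_crtHom43` (generators `![9, 4]`;
all `144` pairs, by `decide`). [folklore] -/
theorem crt43_adj_iff : ∀ k k' : Fin 12,
    (fermionRectTorusGraph 3 4).Adj (toLex (crt34Pair k)) (toLex (crt34Pair k')) ↔
      (((k : ℕ) : ZMod 12) ≠ ((k' : ℕ) : ZMod 12) ∧ ∃ i : Fin 2,
        ((k' : ℕ) : ZMod 12) = ((k : ℕ) : ZMod 12) + ((![9, 4] i : ℤ) : ZMod 12) ∨
          ((k : ℕ) : ZMod 12) = ((k' : ℕ) : ZMod 12) + ((![9, 4] i : ℤ) : ZMod 12)) := by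
  decide

/-- `crtEquiv34` is ALSO a graph isomorphism from the Cayley graph of `crtHom43` (same hop set
`{±9, ±4}`) onto `fermionRectTorusGraph 3 4`. [folklore] -/
theorem fermionRectTorusGraph_adj_crtEquiv34_crtHom43 (x y : FermionTorus 1 12) :
    (fermionRectTorusGraph 3 4).Adj (crtEquiv34 x) (crtEquiv34 y) ↔ (homTorusGraph crtHom43).Adj x y := by
  rw [homTorusGraph_adj, homSiteGraph_adj_iff, show crtEquiv34 x = toLex (crt34Pair (ofLex x 0)) from rfl,
    show crtEquiv34 y = toLex (crt34Pair (ofLex y 0)) from rfl, crt43_adj_iff]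
  have hts : ∀ u : FermionTorus 1 12, u.toTorusSite = fun _ => ((ofLex u 0 : ℕ) : ZMod 12) :=
    fun u => funext fun j => by rw [Subsingleton.elim j 0]; rfl
  have hc : ∀ i : Fin 2, crtHom43 (unitVec i) = fun _ => ((![9, 4] i : ℤ) : ZMod 12) :=
    fun i => ringHom_unitVec 12 ![9, 4] i
  simp only [hts, hc, ne_eq, funext_iff, Fin.forall_fin_one, Pi.add_apply]

/-- **Window certificate (drawn in a `4 × 3` box) ⇒ the `3 × 4` PP Hubbard torus**: as
`rect34_groundEnergyAt_div_ge_of_window_certificate` for windows of coordinate spreads `≤ (3, 2)`.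
[cite: Han2020Bootstrap, §3] -/
theorem rect34_groundEnergyAt_div_ge_of_window_certificate_transposed (t U : ℝ) {nh : ℕ}
    (hn : nh ≤ Fintype.card (FermionTorus 1 12))
    {Λ Λ' : Finset (Site 2)} (hΛ : Λ ⊆ Λ')
    (hspread : ∀ x ∈ Λ', ∀ y ∈ Λ', |x 0 - y 0| ≤ (3 : ℤ) ∧ |x 1 - y 1| ≤ (2 : ℤ))
    (hclosed : ∀ x ∈ Λ, ∀ i : Fin 2, x + unitVec i ∈ Λ' ∧ x - unitVec i ∈ Λ')
    (h0 : thicken ({0} : Finset (Site 2)) 1 ⊆ Λ') (hz : (0 : Site 2) ∈ Λ')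
    (μ : Fin 2 → ℝ) (ν : ℝ)
    {m : Type*} [Fintype m] [DecidableEq m] {Λm : Matrix m m ℂ} (hΛm : Λm.PosSemidef)
    (O : m → FermionOp Λ')
    {κ : Type*} (s : Finset κ) (B : κ → FermionOp Λ)
    {ι : Type*} (tt : Finset ι) (v : ι → Site 2) (hsh : ∀ l, shiftSet (v l) Λ ⊆ Λ') (Y : ι → FermionOp Λ)
    {γ : Type*} (u : Finset γ) (b : γ → ℂ) (cw : γ → List (Orb (PolySite Λ') × Bool))
    (hcw : ∀ j ∈ u, ladderCharge (cw j) ≠ 0 ∨ ladderSpinCharge (cw j) ≠ 0)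
    {δ : Type*} (ah : Finset δ) (dc : δ → ℝ) (V : δ → FermionOp Λ')
    {κ'' : Type*} (w : Finset κ'') (a : κ'' → ℂ) (word : κ'' → List (Orb (PolySite Λ') × Bool)) {c : ℝ}
    (hcert : fermionEmbed (PolySite.incl h0) ((hubbardFermionInteraction 2 t U).meanEnergyObs 1) -
        (c : ℂ) • (1 : FermionOp Λ') -
        ∑ σ : Fin 2, ((μ σ : ℝ) : ℂ) • (nAt 0 hz σ - ((ν : ℝ) : ℂ) • (1 : FermionOp Λ')) =
      gramForm Λm O +
        (∑ k ∈ s, ((hubbardFermionInteraction 2 t U).localHamiltonian Λ' * fermionEmbed (PolySite.incl hΛ) (B k) -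
            fermionEmbed (PolySite.incl hΛ) (B k) * (hubbardFermionInteraction 2 t U).localHamiltonian Λ') +
          ∑ l ∈ tt, (fermionEmbed (PolySite.incl (hsh l)) (fermionEmbed (PolySite.shiftEmb (v l) Λ) (Y l)) -
            fermionEmbed (PolySite.incl hΛ) (Y l)) +
          ∑ j ∈ u, b j • ladderWord (cw j)) +
        (∑ m' ∈ ah, ((dc m' : ℝ) : ℂ) • ((V m')ᴴ - V m') + ∑ k ∈ w, a k • ladderWord (word k))) :
    c - ∑ k ∈ w, ‖a k‖ + (∑ σ : Fin 2, μ σ) * ((nh : ℝ) / 12 - ν) ≤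
      groundEnergyAt (fermionRectTorusGraph 3 4) t U (2 * nh) / 12 := by
  rw [groundEnergyAt_eq_of_iso (homTorusGraph crtHom43) (fermionRectTorusGraph 3 4) crtEquiv34
      fermionRectTorusGraph_adj_crtEquiv34_crtHom43 t U, groundEnergyAt_eq_minEnergyOn_szSector (homTorusGraph crtHom43) t U hn]
  exact crt43_minEnergyOn_div_ge_of_window_certificate t U hn hΛ hspread hclosed h0 hz μ ν hΛm O s B tt v hsh Y
    u b cw hcw ah dc V w a word hcert

/-- The adjacency check behind `fermionRectTorusGraph_adj_crtEquiv35_crtHom53` (generators `![6, 10]`;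
all `225` pairs, by `decide`). [folklore] -/
theorem crt53_adj_iff : ∀ k k' : Fin 15,
    (fermionRectTorusGraph 3 5).Adj (toLex (crt35Pair k)) (toLex (crt35Pair k')) ↔
      (((k : ℕ) : ZMod 15) ≠ ((k' : ℕ) : ZMod 15) ∧ ∃ i : Fin 2,
        ((k' : ℕ) : ZMod 15) = ((k : ℕ) : ZMod 15) + ((![6, 10] i : ℤ) : ZMod 15) ∨
          ((k : ℕ) : ZMod 15) = ((k' : ℕ) : ZMod 15) + ((![6, 10] i : ℤ) : ZMod 15)) := by
  decide

/-- `crtEquiv35` is ALSO a graph isomorphism from the Cayley graph of `crtHom53` (same hop set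
`{±6, ±10}`) onto `fermionRectTorusGraph 3 5`. [folklore] -/
theorem fermionRectTorusGraph_adj_crtEquiv35_crtHom53 (x y : FermionTorus 1 15) :
    (fermionRectTorusGraph 3 5).Adj (crtEquiv35 x) (crtEquiv35 y) ↔ (homTorusGraph crtHom53).Adj x y := by
  rw [homTorusGraph_adj, homSiteGraph_adj_iff, show crtEquiv35 x = toLex (crt35Pair (ofLex x 0)) from rfl,
    show crtEquiv35 y = toLex (crt35Pair (ofLex y 0)) from rfl, crt53_adj_iff]
  have hts : ∀ u : FermionTorus 1 15, u.toTorusSite = fun _ => ((ofLex u 0 : ℕ) : ZMod 15) :=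
    fun u => funext fun j => by rw [Subsingleton.elim j 0]; rfl
  have hc : ∀ i : Fin 2, crtHom53 (unitVec i) = fun _ => ((![6, 10] i : ℤ) : ZMod 15) :=
    fun i => ringHom_unitVec 15 ![6, 10] i
  simp only [hts, hc, ne_eq, funext_iff, Fin.forall_fin_one, Pi.add_apply]

/-- **Window certificate (drawn in a `5 × 3` box) ⇒ the `3 × 5` PP Hubbard torus**: as
`rect35_groundEnergyAt_div_ge_of_window_certificate` for windows of coordinate spreads `≤ (4, 2)`.
[cite: Han2020Bootstrap, §3] -/
theorem rect35_groundEnergyAt_div_ge_of_window_certificate_transposed (t U : ℝ) {nh : ℕ}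
    (hn : nh ≤ Fintype.card (FermionTorus 1 15))
    {Λ Λ' : Finset (Site 2)} (hΛ : Λ ⊆ Λ')
    (hspread : ∀ x ∈ Λ', ∀ y ∈ Λ', |x 0 - y 0| ≤ (4 : ℤ) ∧ |x 1 - y 1| ≤ (2 : ℤ))
    (hclosed : ∀ x ∈ Λ, ∀ i : Fin 2, x + unitVec i ∈ Λ' ∧ x - unitVec i ∈ Λ')
    (h0 : thicken ({0} : Finset (Site 2)) 1 ⊆ Λ') (hz : (0 : Site 2) ∈ Λ')
    (μ : Fin 2 → ℝ) (ν : ℝ)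
    {m : Type*} [Fintype m] [DecidableEq m] {Λm : Matrix m m ℂ} (hΛm : Λm.PosSemidef)
    (O : m → FermionOp Λ')
    {κ : Type*} (s : Finset κ) (B : κ → FermionOp Λ)
    {ι : Type*} (tt : Finset ι) (v : ι → Site 2) (hsh : ∀ l, shiftSet (v l) Λ ⊆ Λ') (Y : ι → FermionOp Λ)
    {γ : Type*} (u : Finset γ) (b : γ → ℂ) (cw : γ → List (Orb (PolySite Λ') × Bool))
    (hcw : ∀ j ∈ u, ladderCharge (cw j) ≠ 0 ∨ ladderSpinCharge (cw j) ≠ 0)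
    {δ : Type*} (ah : Finset δ) (dc : δ → ℝ) (V : δ → FermionOp Λ')
    {κ'' : Type*} (w : Finset κ'') (a : κ'' → ℂ) (word : κ'' → List (Orb (PolySite Λ') × Bool)) {c : ℝ}
    (hcert : fermionEmbed (PolySite.incl h0) ((hubbardFermionInteraction 2 t U).meanEnergyObs 1) -
        (c : ℂ) • (1 : FermionOp Λ') -
        ∑ σ : Fin 2, ((μ σ : ℝ) : ℂ) • (nAt 0 hz σ - ((ν : ℝ) : ℂ) • (1 : FermionOp Λ')) =
      gramForm Λm O +
        (∑ k ∈ s, ((hubbardFermionInteraction 2 t U).localHamiltonian Λ' * fermionEmbed (PolySite.incl hΛ) (B k) -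
            fermionEmbed (PolySite.incl hΛ) (B k) * (hubbardFermionInteraction 2 t U).localHamiltonian Λ') +
          ∑ l ∈ tt, (fermionEmbed (PolySite.incl (hsh l)) (fermionEmbed (PolySite.shiftEmb (v l) Λ) (Y l)) -
            fermionEmbed (PolySite.incl hΛ) (Y l)) +
          ∑ j ∈ u, b j • ladderWord (cw j)) +
        (∑ m' ∈ ah, ((dc m' : ℝ) : ℂ) • ((V m')ᴴ - V m') + ∑ k ∈ w, a k • ladderWord (word k))) :
    c - ∑ k ∈ w, ‖a k‖ + (∑ σ : Fin 2, μ σ) * ((nh : ℝ) / 15 - ν) ≤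
      groundEnergyAt (fermionRectTorusGraph 3 5) t U (2 * nh) / 15 := by
  rw [groundEnergyAt_eq_of_iso (homTorusGraph crtHom53) (fermionRectTorusGraph 3 5) crtEquiv35
      fermionRectTorusGraph_adj_crtEquiv35_crtHom53 t U, groundEnergyAt_eq_minEnergyOn_szSector (homTorusGraph crtHom53) t U hn]
  exact crt53_minEnergyOn_div_ge_of_window_certificate t U hn hΛ hspread hclosed h0 hz μ ν hΛm O s B tt v hsh Y
    u b cw hcw ah dc V w a word hcert

end Transposed

end Summit.Ventures.CertifiedManyBodySolver.Rows

end
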